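import Summits.BirchSwinnertonDyer.BirchSwinnertonDyer.Theorems.ManinLocalTwoThreeKummerDiamondIndexFourShapeNoCES
import HarnessLib

/-!
# The exact residual of C2 beyond CDT: the Kummer values of the quarter-cusp points in the index-`4` world
(route `ManinLocalTwoThree`, crux C2 `ManinOddAtFour` stmt-BirchSwinnertonDyer-22967; cell bsd-f2-manin, prover seat p2 gen 22;
`--supports stmt-BirchSwinnertonDyer-22967`; sequel of `…KummerDiamondIndexFourShapeNoCES`)

What the C2 proof consumes from Stevens 1982 Thm 1.3.1(b) (T-es-75) is ONLY the conclusion of THEOREM K for `X₀(N)`-data in the index-`4`,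
`|c₀| = 2` world — a statement about the lattice-optimal `X₀(N)`-datum alone (no `X₁(N)`-structure, no Stevens curve, no CES): for every
`σ ∈ Aut(ℂ/ℚ)` with `σ(ζ_N) = ζ_N^d`, `dd′ ≡ 1 (N)`, every coprime splitting `N = Q·y` and every `γ ∈ Γ₀(N)` of diamond class
`(d′ mod Q, 1 mod y)`:  `σ(S_y) − S_y = π₀(c₀{∞,γ∞}_f/2)`, where `S_y = π₀(c₀{∞,1/y}_f/2)` is the half of the Atkin–Lehner point `R_y`.
This «index-4 Kummer-values law» is written below as an explicit binder (no definition):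

* `maninOddAtFour_of_CDT_of_indexFourKummerValues : CDT → (law) → ManinOddAtFour` — fact-free otherwise (assembly
  `two_pow_five_dvd_and_hasFreyTwistShape_of_kummerValues`, p3's kernel `2`-torsion theorem, p2's E-es-186♭, the `c`-division chain under CDT);
* `indexFourKummerValues_of_Tes75 : T-es-75 → (law)` — via the flat `X₁(N)`-datum (`indexFour_kummerDiamondReciprocity_of_even`).

So the trust base of C2 reads: CDT Thm 1 + ANY proof of the law (printed road: Stevens 1982 Thm 1.3.1(b) = Shimura reciprocity for the
modular function field at the cusps `[1;y]`; an analytic road would have to compute the Galois action on the torsion points `S_y` — none is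
known to the cell).  HONEST FRAMING: CONDITIONAL results; C2, Manin's conjecture and BSD are NOT proved.  No definitions, no sorry.
[cite: CalegariDimitrovTang2025, Thm. 1] [cite: Stevens1982, §1.3 Thm. 1.3.1 (b)] [cite: Stevens1989, §2]
-/

set_option autoImplicit false
-- lint-debt: the directory name repeats the summit name (sibling precedent `ManinLocalTwoThreeKummerDiamondIndexFourShapeNoCES.lean`)
set_option linter.dupNamespace false

noncomputable section

open scoped Classical MatrixGroups
open Complex CongruenceSubgroup WeierstrassCurve WeierstrassCurve.Affine WeierstrassCurve.Affine.Point
open Literature.NumberTheory.EllipticCurves Literature.NumberTheory.EllipticCurves.ModularForms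
open Literature.NumberTheory.EllipticCurves.Greenberg1999 Literature.NumberTheory.Automorphic

namespace Summit.BirchSwinnertonDyer.BirchSwinnertonDyer.Theorems.ManinLocalTwoThree.KummerDiamondIndexFourNoCES

/-- **C2 `ManinOddAtFour` ⟸ CDT ∧ the index-`4` Kummer-values law** (explicit binder `hK`; NO other printed fact).  This isolates the exact
residual input of C2 beyond CDT as a statement about `X₀(N)`-data.  CONDITIONAL; C2 is not proved by this.
[cite: CalegariDimitrovTang2025, Thm. 1] [cite: Stevens1989, §2] -/
theorem maninOddAtFour_of_CDT_of_indexFourKummerValues (hCDT : CalegariDimitrovTang2025_unboundedDenominators)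
    (hK : ∀ (W₀ : WeierstrassCurve ℚ) [W₀.IsElliptic] [W₀.IsGloballyMinimal] {N : ℕ} [NeZero N] (D₀ : ModularParametrizationData W₀ N),
      (∀ z ∈ D₀.L.lattice, ∃ w ∈ periodLattice D₀.f, z = D₀.c * w) → D₀.c.natAbs = 2 →
      (∀ z : ℂ, z ∈ periodLatticeGamma1 D₀.f ↔ ∃ w ∈ periodLattice D₀.f, z = 2 * w) →
      ∀ (σ : ℂ ≃ₐ[ℚ] ℂ) (d d' : ℤ), ((d * d' : ℤ) : ZMod N) = 1 →
        σ (Complex.exp (2 * Real.pi * Complex.I / N)) = Complex.exp (2 * Real.pi * Complex.I * d / N) →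
        ∀ (Q y : ℕ), Q * y = N → Nat.Coprime Q y → ∀ γ : Gamma0 N,
          (((γ : SL(2, ℤ)) 1 1 : ℤ) : ZMod Q) = (d' : ZMod Q) → (((γ : SL(2, ℤ)) 1 1 : ℤ) : ZMod y) = 1 →
          Affine.Point.map (W' := W₀) (σ : ℂ →ₐ[ℚ] ℂ) (D₀.uniformize ((D₀.c : ℂ) * modularSymbol D₀.f (1 / (y : ℚ)) / 2)) =
            D₀.uniformize ((D₀.c : ℂ) * modularSymbol D₀.f (1 / (y : ℚ)) / 2) +
              D₀.uniformize ((D₀.c : ℂ) * cuspSymbol D₀.f γ / 2)) :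
    Summit.BirchSwinnertonDyer.BirchSwinnertonDyer.Theses.ManinLocalTwoThree.ManinOddAtFour :=
  CDivTranslate.maninOddAtFour_of_CDTInt_shape185Flat hCDT fun W₀ _ _ _ _ D₀ hopt hc2 h4 h3 ↦
    two_pow_five_dvd_and_hasFreyTwistShape_of_kummerValues W₀ D₀ hopt h4 h3 (hK W₀ D₀ hopt hc2 h4)

/-- **The index-`4` Kummer-values law ⟸ T-es-75** (via the flat `X₁(N)`-datum; `|c₀| = 2` is used only through `2 ∣ c₀`).
[cite: Stevens1982, §1.3 Thm. 1.3.1 (b)] [cite: Stevens1989, §2] -/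
theorem indexFourKummerValues_of_Tes75 (hSt : optimalGamma1Parametrization_cuspInv_galoisAction) :
    ∀ (W₀ : WeierstrassCurve ℚ) [W₀.IsElliptic] [W₀.IsGloballyMinimal] {N : ℕ} [NeZero N] (D₀ : ModularParametrizationData W₀ N),
      (∀ z ∈ D₀.L.lattice, ∃ w ∈ periodLattice D₀.f, z = D₀.c * w) → D₀.c.natAbs = 2 →
      (∀ z : ℂ, z ∈ periodLatticeGamma1 D₀.f ↔ ∃ w ∈ periodLattice D₀.f, z = 2 * w) →
      ∀ (σ : ℂ ≃ₐ[ℚ] ℂ) (d d' : ℤ), ((d * d' : ℤ) : ZMod N) = 1 →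
        σ (Complex.exp (2 * Real.pi * Complex.I / N)) = Complex.exp (2 * Real.pi * Complex.I * d / N) →
        ∀ (Q y : ℕ), Q * y = N → Nat.Coprime Q y → ∀ γ : Gamma0 N,
          (((γ : SL(2, ℤ)) 1 1 : ℤ) : ZMod Q) = (d' : ZMod Q) → (((γ : SL(2, ℤ)) 1 1 : ℤ) : ZMod y) = 1 →
          Affine.Point.map (W' := W₀) (σ : ℂ →ₐ[ℚ] ℂ) (D₀.uniformize ((D₀.c : ℂ) * modularSymbol D₀.f (1 / (y : ℚ)) / 2)) =
            D₀.uniformize ((D₀.c : ℂ) * modularSymbol D₀.f (1 / (y : ℚ)) / 2) +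
              D₀.uniformize ((D₀.c : ℂ) * cuspSymbol D₀.f γ / 2) := by
  intro W₀ _ _ _ _ D₀ hopt hc2 h4 σ d d' hdd' hσ Q y hQy hcop γ hγQ hγy
  have heven : (2 : ℤ) ∣ D₀.c := by
    rw [← Int.natAbs_dvd_natAbs]
    simp [hc2]
  exact indexFour_kummerDiamondReciprocity_of_even W₀ D₀ hSt hopt heven h4 σ d d' hdd' hσ Q y hQy hcop γ hγQ hγy

end Summit.BirchSwinnertonDyer.BirchSwinnertonDyer.Theorems.ManinLocalTwoThree.KummerDiamondIndexFourNoCES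

end
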